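import Summits.AtomisticToContinuum.Crystallization.Theses.ChessboardParticlePlanes
import Summits.AtomisticToContinuum.Crystallization.Theorems.ChessboardParticlePlanesLjBilayerHcpStubPresentation

/-!
# Crux `ChessboardParticlePlanes.LjPlaneChessboard` (stmt-AtomisticToContinuum-6709), line `Sketch`,
# stub 4 `stub_pointsCongr` — the energy per particle depends only on the point set

Two presentations `(G, F)`, `(G', F')` of the same periodic point set `S = F + G = F' + G'` have the
same energy per particle `(2·#F)⁻¹ ∑_{x ∈ F} ∑_{y ∈ S, y ≠ x} V |x - y|`, for every pair potential
and with no summability assumption.  [folklore; Blanc–Lewin 2015 §2.1 (23)]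

This is the specialisation `v = 0`, `d = 3` of the presentation-invariance lemma proved for the
sibling crux `LjBilayerHcp` (`presentation_energy_eq_of_points_eq` in
`Theorems/ChessboardParticlePlanesLjBilayerHcpStubPresentation.lean`), which carries out the
transversal argument (finite index of `G ⊓ G'` in `G` and `G'`, two systems of representatives of
`S` modulo `G ⊓ G'`, invariance of the site sum under every period of `S`) in every dimension.
-/

noncomputable section

namespace Summit.AtomisticToContinuum.Crystallization.Theorems.ChessboardParticlePlanesLjPlaneChessboard

open Literature.MathematicalPhysics.StatisticalMechanics

/-- **Stub 4 — the energy per particle depends only on the point set (M).**  Two presentations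
`(G, F)`, `(G', F')` of the same periodic point set `S` have the same energy per particle, for
every pair potential (no summability needed). [folklore; Blanc–Lewin 2015 §2.1 (23)] -/
theorem stub_pointsCongr :
    ∀ B B' : PeriodicConfiguration 3, B.points = B'.points →
      ∀ V : ℝ → ℝ, B.energyPerParticle V = B'.energyPerParticle V :=
  fun B B' h V => LjBilayerHcpSketch.presentation_energy_eq_of_points_eq V B B' h

end Summit.AtomisticToContinuum.Crystallization.Theorems.ChessboardParticlePlanesLjPlaneChessboard

end
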